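import Summits.RiemannHypothesis.RiemannHypothesis.Theses.RobinFullPortrait
import HarnessLib

/-!
# `RobinFullPortrait.RangeLeg` (item stmt-RiemannHypothesis-24271) — L50 «ROBIN · 26-FULL PORTRAIT», range leg

Port of `rangeLeg_holds` (proof body verbatim up to one typer delta, see the comment in the proof) from planner rh-idea-4 g2's kernel-checked route sketch
`pub/ideators/rh-idea-4/l50/Sketch.lean` (sha16 15b0019a3d27a5cb): under the two θ-prints (Büthe 2018 Thm 2,
Broadbent et al. 2021) and `RiemannHypothesisUpTo 1.82·10¹⁰`, Robin's inequality holds for every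
`5040 < n < primorial (2^61 − 1)` — a corollary of the tree row H-TOP `RobinFiniteC1.robin_le_of_rhPlatt2017H`
(Robin up to `log n < 0.99947·(10¹⁹ − 1)`-type heights), since `primorial (2^61−1) ≤ 4^(2^61−1) ≤ 10^(43·10¹⁷)`.
Label of record (director-rh g12 (Z1)): «(record) L50 range leg from `robin_le_of_rhPlatt2017H`; 0 toward RH».
Cell rh-split, typer-3 g3 filing.  Nothing here bears on the truth of RH.
-/

set_option linter.dupNamespace false  -- the mandated namespace repeats `RiemannHypothesis`

namespace Summit.RiemannHypothesis.RiemannHypothesis.Theorems.RobinFullPortrait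

open Summit.RiemannHypothesis.RiemannHypothesis.Theorems.Splittings

/-- **`RangeLeg` (item stmt-RiemannHypothesis-24271) holds**: a theorem of the tree today (row H-TOP corollary
`RobinFiniteC1.robin_le_of_rhPlatt2017H`), the range `n < primorial (2^61 − 1)` being far inside
`10^(43·10¹⁷)`. [folklore] -/
theorem rangeLeg_proof : Summit.RiemannHypothesis.RiemannHypothesis.Theses.RobinFullPortrait.RangeLeg := by
  intro hB hK hRH n hn hlt
  refine RobinFiniteC1.robin_le_of_rhPlatt2017H hB hK le_rfl hRH n hn ?_
  -- `primorial q ≤ 4 ^ q ≤ 4 ^ (43·10¹⁷) ≤ 10 ^ (43·10¹⁷)` for `q ≤ 43·10¹⁷`, stated for a bound variable `q` so that no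
  -- numeral power with a huge literal exponent is ever formed (Sketch lines h1–h3, same three tree/Mathlib lemmas).
  have key : ∀ q : ℕ, q ≤ 43 * 10 ^ 17 → primorial q ≤ 10 ^ (43 * 10 ^ 17) := fun q hq =>
    (primorial_le_four_pow q).trans
      ((Nat.pow_le_pow_right (by norm_num) hq).trans (Nat.pow_le_pow_left (by norm_num) _))
  exact le_of_lt (lt_of_lt_of_le hlt (key _ (by norm_num)))

end Summit.RiemannHypothesis.RiemannHypothesis.Theorems.RobinFullPortrait
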